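import Mathlib
import Summits.Ventures.PercRepro2.HCov
import Summits.Ventures.PercRepro2.HCovSwap
import Summits.Ventures.PercRepro2.ContractDefs
import Summits.Ventures.PercRepro2.RECMReduction
import Summits.Ventures.PercRepro2.GcTransport

/-!
# Transport of the covariance form on the marks, and the series pushforward (blind cell PercRepro2,
p1 g11; the tools of the series / leaf rules of `GcSeries.lean`)

* **`Gc_transport_marks`**: the transport lemma `Gc_transport` of `GcTransport.lean` with the
  connectivity hypothesis restricted to the five marks — `Gc` is a polynomial in probabilities of
  events built from `Conn` between marks by `∩`, `∪`, `ᶜ`, so a configuration map `Ψ` with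
  `P_q(A) = P_p(Ψ⁻¹ A)` and a vertex map `φ` with `Conn ends (Ψ ω) x z ↔ Conn ends' ω (φ x) (φ z)`
  for marks `x, z` carry `Gc q ends` to `Gc p ends'`;
* **`seriesMap e f`** `= ω ↦ ω[f ↦ ω_e ∧ ω_f][e ↦ false]` and **`prob_series_pushforward`**: under
  `p` the series map has the law `p[f ↦ p_e · p_f][e ↦ 0]` — two edges in series are one edge with
  the product weight (pinning at `e` then `f`, `expect_eq_pin` / `expect_update_zero`).
-/

namespace Summit.Ventures.PercRepro2

open CovForm Contract

namespace RECM

/-! ## Transport of `Gc` with the connectivity hypothesis on the marks only -/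

section TransportMarks

variable {V : Type*} {E : Type*} [Fintype E] [DecidableEq E] [DecidableEq V] {R : Type*}
  [Field R] [LinearOrder R]

omit [Fintype E] [DecidableEq E] [DecidableEq V] in
/-- Preimage of a connection event between two vertices of a set `M` on which `Ψ`, `φ` transport
connectivity. -/
lemma preimage_connEvent_of_mem {ends ends' : E → Sym2 V} {Ψ : Config E → Config E} {φ : V → V}
    {M : Set V} (hH : ∀ ω, ∀ x ∈ M, ∀ z ∈ M, Conn ends (Ψ ω) x z ↔ Conn ends' ω (φ x) (φ z))
    {x z : V} (hx : x ∈ M) (hz : z ∈ M) :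
    Ψ ⁻¹' connEvent ends x z = connEvent ends' (φ x) (φ z) := by
  ext ω
  simp [hH ω x hx z hz]

omit [Fintype E] [DecidableEq E] [DecidableEq V] in
/-- Preimage of a one-point avoidance event between marks. -/
lemma preimage_avoidAll_singleton_of_mem {ends ends' : E → Sym2 V} {Ψ : Config E → Config E}
    {φ : V → V} {M : Set V}
    (hH : ∀ ω, ∀ x ∈ M, ∀ z ∈ M, Conn ends (Ψ ω) x z ↔ Conn ends' ω (φ x) (φ z))
    {s x : V} (hs : s ∈ M) (hx : x ∈ M) :
    Ψ ⁻¹' avoidAll ends s {x} = avoidAll ends' (φ s) {φ x} := by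
  ext ω
  simp [avoidAll, hH ω s hs x hx]

omit [Fintype E] [DecidableEq E] [DecidableEq V] in
/-- Preimage of `PDEvent` between marks. -/
lemma preimage_PDEvent_of_mem {ends ends' : E → Sym2 V} {Ψ : Config E → Config E} {φ : V → V}
    {M : Set V} (hH : ∀ ω, ∀ x ∈ M, ∀ z ∈ M, Conn ends (Ψ ω) x z ↔ Conn ends' ω (φ x) (φ z))
    {a₁ a₂ a₃ : V} (h1 : a₁ ∈ M) (h2 : a₂ ∈ M) (h3 : a₃ ∈ M) :
    Ψ ⁻¹' PDEvent ends a₁ a₂ a₃ = PDEvent ends' (φ a₁) (φ a₂) (φ a₃) := by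
  simp only [PDEvent, Dtilde, UnionCluster.inU, Set.preimage_inter, Set.preimage_compl,
    Set.preimage_union, preimage_connEvent_of_mem hH h1 h2, preimage_connEvent_of_mem hH h3 h1,
    preimage_connEvent_of_mem hH h3 h2]

omit [Fintype E] [DecidableEq E] [DecidableEq V] in
/-- Preimage of `TEvent` between marks. -/
lemma preimage_TEvent_of_mem {ends ends' : E → Sym2 V} {Ψ : Config E → Config E} {φ : V → V}
    {M : Set V} (hH : ∀ ω, ∀ x ∈ M, ∀ z ∈ M, Conn ends (Ψ ω) x z ↔ Conn ends' ω (φ x) (φ z))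
    {a₁ a₂ a₃ : V} (h1 : a₁ ∈ M) (h2 : a₂ ∈ M) (h3 : a₃ ∈ M) :
    Ψ ⁻¹' TEvent ends a₁ a₂ a₃ = TEvent ends' (φ a₁) (φ a₂) (φ a₃) := by
  simp only [TEvent, Set.preimage_inter, Set.preimage_compl, preimage_connEvent_of_mem hH h2 h1,
    preimage_connEvent_of_mem hH h2 h3]

omit [DecidableEq V] [LinearOrder R] in
/-- **Transport of the covariance form, marks only**: `P_q(A) = P_p(Ψ⁻¹ A)` for every event and
`Ψ`, `φ` transport connectivity between the five marks ⟹ `Gc` is carried along. -/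
theorem Gc_transport_marks {q p : E → R} {ends ends' : E → Sym2 V} {Ψ : Config E → Config E}
    {φ : V → V} (hP : ∀ A : Set (Config E), prob q A = prob p (Ψ ⁻¹' A)) (o a₁ a₂ a₃ b : V)
    (hH : ∀ ω, ∀ x ∈ ({o, a₁, a₂, a₃, b} : Set V), ∀ z ∈ ({o, a₁, a₂, a₃, b} : Set V),
      Conn ends (Ψ ω) x z ↔ Conn ends' ω (φ x) (φ z)) :
    Gc q ends o a₁ a₂ a₃ b = Gc p ends' (φ o) (φ a₁) (φ a₂) (φ a₃) (φ b) := by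
  have ho : o ∈ ({o, a₁, a₂, a₃, b} : Set V) := by simp
  have h1 : a₁ ∈ ({o, a₁, a₂, a₃, b} : Set V) := by simp
  have h2 : a₂ ∈ ({o, a₁, a₂, a₃, b} : Set V) := by simp
  have h3 : a₃ ∈ ({o, a₁, a₂, a₃, b} : Set V) := by simp
  have hb : b ∈ ({o, a₁, a₂, a₃, b} : Set V) := by simp
  simp only [Gc, DEF, EQbo, EQb3, EQb3o, EQo, EQ3, EQ3o, PDb, PDbo, Do, gap, hP,
    Set.preimage_inter, preimage_PDEvent_of_mem hH h1 h2 h3, preimage_TEvent_of_mem hH h1 h2 h3,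
    preimage_TEvent_of_mem hH h2 h1 h3, preimage_connEvent_of_mem hH h1 ho,
    preimage_connEvent_of_mem hH h2 ho, preimage_connEvent_of_mem hH h1 hb,
    preimage_connEvent_of_mem hH h2 hb, preimage_avoidAll_singleton_of_mem hH h2 h1]

end TransportMarks

/-! ## The series pushforward: `ω ↦ ω[f ↦ ω_e ∧ ω_f][e ↦ false]` has law `p[f ↦ p_e p_f][e ↦ 0]` -/

section Pushforward

variable {E : Type*} [Fintype E] [DecidableEq E] {R : Type*} [CommRing R]

/-- The series map at the edges `e, f`: `f` becomes open iff both were open, `e` is closed. -/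
def seriesMap (e f : E) (ω : Config E) : Config E :=
  Function.update (Function.update ω f (ω e && ω f)) e false

/-- Expectations only see the observable on the support of the weights. -/
lemma expect_congr_support (q : E → R) {g g' : Config E → R}
    (h : ∀ ω, weight q ω ≠ 0 → g ω = g' ω) : expect q g = expect q g' := by
  unfold expect
  refine Finset.sum_congr rfl fun ω _ => ?_
  by_cases hw : weight q ω = 0
  · rw [hw, zero_mul, zero_mul]
  · rw [h ω hw]

omit [Fintype E] in
/-- On the support of `q[e ↦ 1]` the edge `e` is open. -/
lemma eq_true_of_weight_update_one_ne_zero [Fintype E] (q : E → R) (e : E) {ω : Config E}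
    (h : weight (Function.update q e 1) ω ≠ 0) : ω e = true := by
  by_contra hc
  rw [Bool.not_eq_true] at hc
  exact h (weight_update_one_of_eq_false q hc)

omit [Fintype E] in
/-- On the support of `q[e ↦ 0]` the edge `e` is closed. -/
lemma eq_false_of_weight_update_zero_ne_zero [Fintype E] (q : E → R) (e : E) {ω : Config E}
    (h : weight (Function.update q e 0) ω ≠ 0) : ω e = false := by
  by_contra hc
  rw [Bool.not_eq_false] at hc
  exact h (weight_update_zero_of_eq_true q hc)

/-- **The series pushforward**: under `p`, `seriesMap e f` has the law `p[f ↦ p_e p_f][e ↦ 0]`. -/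
theorem prob_series_pushforward (p : E → R) {e f : E} (hef : e ≠ f) (A : Set (Config E)) :
    prob (Function.update (Function.update p f (p e * p f)) e 0) A =
      prob p (seriesMap e f ⁻¹' A) := by
  rw [prob_eq_expect_indicator, prob_eq_expect_indicator]
  set g : Config E → R := A.indicator 1 with hg
  have hpre : ∀ ω, (seriesMap e f ⁻¹' A).indicator (1 : Config E → R) ω = g (seriesMap e f ω) := by
    intro ω
    by_cases h : seriesMap e f ω ∈ A
    · have h' : ω ∈ seriesMap e f ⁻¹' A := h
      simp only [hg, Set.indicator_of_mem h, Set.indicator_of_mem h', Pi.one_apply]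
    · have h' : ω ∉ seriesMap e f ⁻¹' A := h
      simp only [hg, Set.indicator_of_notMem h, Set.indicator_of_notMem h']
  rw [show (seriesMap e f ⁻¹' A).indicator (1 : Config E → R) = fun ω => g (seriesMap e f ω) from
    funext hpre]
  -- the left side: pin `f` (the weight of `e` is `0`)
  have hL : expect (Function.update (Function.update p f (p e * p f)) e 0) g =
      p e * p f * expect (Function.update (Function.update p f 1) e 0) g +
        (1 - p e * p f) * expect (Function.update (Function.update p f 0) e 0) g := by
    rw [expect_eq_pin _ g f, Function.update_comm hef, Function.update_idem, Function.update_comm hef,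
      Function.update_idem, Function.update_of_ne hef.symm, Function.update_self]
  -- the right side: pin `e`, then `f`
  have hR1 : expect (Function.update (Function.update p e 1) f 1) (fun ω => g (seriesMap e f ω)) =
      expect (Function.update (Function.update p f 1) e 0) g := by
    rw [expect_congr_support _ (g' := fun ω => g (Function.update ω e false))]
    · rw [← expect_update_zero, Function.update_comm hef, Function.update_idem]
    · intro ω hw
      have hf : ω f = true := eq_true_of_weight_update_one_ne_zero _ f hw
      rw [Function.update_comm hef] at hw
      have he : ω e = true := eq_true_of_weight_update_one_ne_zero _ e hw
      simp only [seriesMap]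
      rw [show Function.update ω f (ω e && ω f) = ω from
        Function.update_eq_self_iff.mpr (by rw [he, hf]; rfl)]
  have hR2 : expect (Function.update (Function.update p e 1) f 0) (fun ω => g (seriesMap e f ω)) =
      expect (Function.update (Function.update p f 0) e 0) g := by
    rw [expect_congr_support _ (g' := fun ω => g (Function.update ω e false))]
    · rw [← expect_update_zero, Function.update_comm hef, Function.update_idem]
    · intro ω hw
      have hf : ω f = false := eq_false_of_weight_update_zero_ne_zero _ f hw
      simp only [seriesMap, hf, Bool.and_false]
      rw [show Function.update ω f false = ω from Function.update_eq_self_iff.mpr hf.symm]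
  have hR3 : expect (Function.update p e 0) (fun ω => g (seriesMap e f ω)) =
      expect (Function.update (Function.update p f 0) e 0) g := by
    rw [expect_congr_support _ (g' := fun ω => g (Function.update ω f false))]
    · rw [← expect_update_zero, Function.update_comm hef]
    · intro ω hw
      have he : ω e = false := eq_false_of_weight_update_zero_ne_zero _ e hw
      simp only [seriesMap, he, Bool.false_and]
      rw [show Function.update (Function.update ω f false) e false = Function.update ω f false from
        Function.update_eq_self_iff.mpr (by rw [Function.update_of_ne hef]; exact he.symm)]
  rw [hL, expect_eq_pin p _ e, expect_eq_pin (Function.update p e 1) _ f, hR1, hR2, hR3,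
    Function.update_of_ne hef.symm]
  ring

end Pushforward

end RECM

end Summit.Ventures.PercRepro2
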